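import Summits.QuantumFields.YangMills.Theorems.BalabanUVNodesN19LawIncrementsTarget

/-!
# YM-DAG node N19 (= NE7 proper) — `Target` DOES NOT GIVE SUMMABLE LAW INCREMENTS: a sequence of laws, window-summable (N19's `Target` holds with
# `δ_K ≤ e^{l₀}∕(2(K+1)²)`) whose bounded-Lipschitz increments are `≥ c∕(K+1)` — the converse of module 64 is STRICTLY one-way

Cell `pub-ymgap`, HUMAN RULING D-0062 (Track A) ∕ D-0149 (work-bound push), R141 (C) wider-strategy seat `pub-ymgap-dag-n19-e` (strategy s3 =
ALTERNATIVE CURRENCY), generation g21, module 5 (lineage module 68).  Route `Summits/QuantumFields/YangMills/Theses/BalabanUVNodes.lean` rev 25,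
cluster item K3⁷ «SpineGivenEndpointR13SepCoPH» (stmt-QuantumFields-20544); filed `--supports` that item `--as helper` (it proves no registered
stub).  COUNT-NEUTRAL: [folklore] probability over Mathlib + the lineage BY NAME — module 64 `…N19LawIncrementsTarget` (`abs_log_sub_log_le_of_exp_neg_le`,
`exp_neg_le_mgf_id_of_Icc_symm`), p543481 `…N19LawPrice` (`exists_cgf_close_laws_far`, `lipschitzWith_one_cosWave`, `cosWave_nonneg`, `cosWave_le`),
p555512 `…N19LawPriceTwoSided` (`Icc_symm_compl_null_of_Icc`); `Spine.NE7.Target` (N19's DECL-target SHAPE) is CONCLUDED for an explicit toy family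
`Z_K(t) = mgf λ_K(t)`; no scheme object, no Theses import; NOT a discharge claim.

THE QUESTION.  Module 64: summable bounded-Lipschitz law increments `D_K` ⇒ `Spine.NE7.Target` with `vol·δ_K = (l₀+1)e^{2l₀}D_K` (linear); module 62:
`Target` ⇒ law convergence at `48(K+G)∕(1 + log R_K⁻¹)` — a rate that is NOT summable for the programme's geometric remainders.  Is that a defect of
the proof, or is N19's `Target` genuinely WEAKER than summability in the law currency?

THE ANSWER: GENUINELY WEAKER.  ★★ `exists_target_not_summable_lawIncrements`: for every window `l₀ > 0` there is a sequence of probability laws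
`λ_K` on `[0,1]` such that `Spine.NE7.Target 1 l₀ δ (K ↦ t ↦ mgf λ_K(t))` holds with `δ_K ≤ e^{l₀}∕(2(K+1)²)` (the cgfs have increments
`≤ e^{l₀}∕(2(K+1)²)` uniformly on `|t| ≤ l₀` — summable, constants `c_K = 0`), while for `1`-Lipschitz `[0,1]`-valued test functions `g_K`
`|∫g_K dλ_{K+1} − ∫g_K dλ_K| ≥ c(l₀)∕(K+1)` with `c(l₀) = 1∕(4π(⌈l₀e^{l₀}⌉ + 2))` — so the bounded-Lipschitz increments are NOT summable
(`not_summable_lawIncrements`).  THE CONSTRUCTION (one base law, geometric perturbations): with p543481's binomial pairs `(μ_b, ν_b)` at the levels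
`p_b = 2b + 2 + N₀`, `N₀ = ⌈l₀e^{l₀}⌉` (mgfs `ε_b ≤ 2·4^{−(b+1)}`-close on the window, the wave `(1 − cos πp_bx)∕(πp_b)` paid `2∕(πp_b)`), take the
MIXTURE `λ⁰ = Σ_b w_b μ_b` with `w_b = (b+1)∕2^{b+2}` (`Σ_b w_b = 1`) as base and `λ^{(b)}` = the same mixture with `μ_b` replaced by `ν_b`; run through
the blocks `K + 1 ∈ [2^b, 2^{b+1})` alternating `λ⁰` (even `K`) and `λ^{(b)}` (odd `K`).  Every increment is `λ⁰ ↔ λ^{(b′)}` with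
`b′ ∈ {b(K), b(K)+1}`: in cgf it costs `≤ e^{l₀}·w_{b′}ε_{b′} ≤ (e^{l₀}∕2)·4^{−(b(K)+1)} < (e^{l₀}∕2)∕(K+1)²` (mgfs `≥ e^{−l₀}`, `(K+1)² < 4^{b(K)+1}`),
in the bounded-Lipschitz metric it pays `w_{b′}·2∕(πp_{b′}) ≥ 2^{−(b′+1)}∕(π(N₀+2)) ≥ 1∕(4π(N₀+2)(K+1))` (`2^{b(K)} ≤ K+1`).  The mixtures are
`Measure.sum`s; the one-component swap is priced by `hasSum_integral_measure` + `HasSum.update'`.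
SO (with module 64): LAW-summable ⇒ `Target` ⇒ LAW-convergent, and NEITHER arrow reverses — the window (N19's `Target`) is STRICTLY the cheaper
currency; a road proving summable law-level convergence of the string observables would prove MORE than node U5 asks.

HONEST FRAMING (binding).  Elementary and [folklore] (mixtures of signed-binomial pairs); a TOY family (no scheme object: `Target`'s `Z` slot is fed
`mgf λ_K`, `vol = 1`); NO consumer in the DAG today (a structural statement about the seat's own currencies); nothing of Bałaban's instantiated; NE7 NOT
PRINTED, NOT proved; N19 NOT discharged; count-neutral.  One finite `T⁴` programme at fixed `ε`; nothing continuum ∕ `ℝ⁴` ∕ OS ∕ mass-gap ∕ Clay.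
0 `def` ∕ 0 `sorry`.
-/

noncomputable section

open Real Filter Topology MeasureTheory ProbabilityTheory

namespace Summit.QuantumFields.YangMills.Theorems.BalabanUVNodesN19TargetNotLawSummable

open Literature.MathematicalPhysics.QuantumFieldTheory.Balaban1983to89
open T4CauchySum (MatchingModConstants)
open Summit.QuantumFields.BalabanUV.T4Continuum.Spine
open Summit.QuantumFields.YangMills.Theorems.BalabanUVNodesN19LawIncrementsTarget (abs_log_sub_log_le_of_exp_neg_le exp_neg_le_mgf_id_of_Icc_symm)
open Summit.QuantumFields.YangMills.Theorems.BalabanUVNodesN19LawPrice (exists_cgf_close_laws_far lipschitzWith_one_cosWave cosWave_nonneg cosWave_le)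
open Summit.QuantumFields.YangMills.Theorems.BalabanUVNodesN19LawPriceTwoSided (Icc_symm_compl_null_of_Icc)

/-! ## §1 Countable mixtures of laws on `[0,1]`: mass, support, integrals, the one-component swap [folklore] -/

/-- The weights `w_b = (b+1)∕2^{b+2}` sum to `1` (`Σ b x^b = x∕(1−x)²`, `Σ x^b = 1∕(1−x)` at `x = ½`). [bookkeeping] -/
theorem hasSum_mixtureWeights : HasSum (fun b : ℕ => ((b : ℝ) + 1) * (1 / 2 : ℝ) ^ (b + 2)) 1 := by
  have hr : ‖(1 / 2 : ℝ)‖ < 1 := by rw [Real.norm_eq_abs, abs_of_pos (by norm_num)]; norm_num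
  have h1 : HasSum (fun b : ℕ => (b : ℝ) * (1 / 2 : ℝ) ^ b) ((1 / 2) / (1 - 1 / 2) ^ 2) :=
    (summable_pow_mul_geometric_of_norm_lt_one 1 hr |>.congr fun b => by rw [pow_one]).hasSum_iff.2
      (tsum_coe_mul_geometric_of_norm_lt_one hr)
  have h2 : HasSum (fun b : ℕ => (1 / 2 : ℝ) ^ b) (1 - 1 / 2)⁻¹ := hasSum_geometric_of_lt_one (by norm_num) (by norm_num)
  have h := (h1.add h2).mul_left (1 / 4 : ℝ)
  have e1 : (fun b : ℕ => ((b : ℝ) + 1) * (1 / 2 : ℝ) ^ (b + 2)) = fun b : ℕ => 1 / 4 * ((b : ℝ) * (1 / 2 : ℝ) ^ b + (1 / 2 : ℝ) ^ b) := by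
    funext b; ring
  have h' : HasSum (fun b : ℕ => ((b : ℝ) + 1) * (1 / 2 : ℝ) ^ (b + 2)) (1 / 4 * ((1 / 2) / (1 - 1 / 2) ^ 2 + (1 - 1 / 2)⁻¹)) := by
    rw [e1]; exact h
  have e2 : (1 / 4 : ℝ) * ((1 / 2) / (1 - 1 / 2) ^ 2 + (1 - 1 / 2)⁻¹) = 1 := by norm_num
  rwa [e2] at h'

/-- The weights are positive and at most `¼` (`b + 1 ≤ 2^b`). [bookkeeping] -/
theorem mixtureWeights_pos_le (b : ℕ) : 0 < ((b : ℝ) + 1) * (1 / 2 : ℝ) ^ (b + 2) ∧ ((b : ℝ) + 1) * (1 / 2 : ℝ) ^ (b + 2) ≤ 1 / 4 := by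
  refine ⟨by positivity, ?_⟩
  have hb' : b + 1 ≤ 2 ^ b := Nat.lt_two_pow_self
  have hb : (b : ℝ) + 1 ≤ 2 ^ b := by exact_mod_cast hb'
  rw [pow_add, one_div, inv_pow, inv_pow]
  have h2 : (0 : ℝ) < 2 ^ b := by positivity
  calc ((b : ℝ) + 1) * ((2 ^ b)⁻¹ * (2 ^ 2)⁻¹) ≤ 2 ^ b * ((2 ^ b)⁻¹ * (2 ^ 2)⁻¹) := mul_le_mul_of_nonneg_right hb (by positivity)
    _ = 1 / 4 := by field_simp; norm_num

variable {κ : ℕ → Measure ℝ} [∀ b, IsProbabilityMeasure (κ b)] {w : ℕ → ℝ}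

/-- A countable mixture `Σ_b w_b κ_b` of probability laws with weights `w_b ≥ 0`, `Σ w_b = 1`, is a probability law. [folklore] -/
theorem isProbabilityMeasure_lawMixture (hw0 : ∀ b, 0 ≤ w b) (hw : HasSum w 1) :
    IsProbabilityMeasure (Measure.sum fun b => ENNReal.ofReal (w b) • κ b) := by
  refine ⟨?_⟩
  rw [Measure.sum_apply _ MeasurableSet.univ]
  simp only [Measure.smul_apply, measure_univ, smul_eq_mul, mul_one]
  rw [← ENNReal.ofReal_tsum_of_nonneg hw0 hw.summable, hw.tsum_eq, ENNReal.ofReal_one]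

omit [∀ b, IsProbabilityMeasure (κ b)] in
/-- A mixture of laws carried by a measurable set is carried by it. [folklore] -/
theorem lawMixture_null {s : Set ℝ} (hs : MeasurableSet s) (hκ : ∀ b, κ b sᶜ = 0) :
    (Measure.sum fun b => ENNReal.ofReal (w b) • κ b) sᶜ = 0 := by
  rw [Measure.sum_apply _ hs.compl]
  simp only [Measure.smul_apply, hκ, smul_zero, tsum_zero]

/-- Integration against a mixture of laws on `[0,1]`: for continuous `g`, `∫g d(Σ_b w_b κ_b) = Σ_b w_b ∫g dκ_b` (as a `HasSum`; `g` is bounded on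
`[0,1]`, hence integrable against the mixture). [folklore] -/
theorem hasSum_integral_lawMixture (hw0 : ∀ b, 0 ≤ w b) (hw : HasSum w 1) (hκ : ∀ b, κ b (Set.Icc (0 : ℝ) 1)ᶜ = 0)
    {g : ℝ → ℝ} (hg : Continuous g) :
    HasSum (fun b => w b * ∫ x, g x ∂κ b) (∫ x, g x ∂Measure.sum fun b => ENNReal.ofReal (w b) • κ b) := by
  haveI := isProbabilityMeasure_lawMixture (κ := κ) hw0 hw
  obtain ⟨C, hC⟩ := (isCompact_Icc : IsCompact (Set.Icc (0 : ℝ) 1)).exists_bound_of_continuousOn hg.continuousOn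
  have hae : ∀ᵐ x ∂(Measure.sum fun b => ENNReal.ofReal (w b) • κ b), x ∈ Set.Icc (0 : ℝ) 1 :=
    mem_ae_iff.2 (lawMixture_null measurableSet_Icc hκ)
  have hint : Integrable g (Measure.sum fun b => ENNReal.ofReal (w b) • κ b) :=
    (integrable_const C).mono' hg.aestronglyMeasurable (hae.mono fun x hx => hC x hx)
  have h := hasSum_integral_measure hint
  refine h.congr_fun fun b => ?_
  rw [integral_smul_measure, ENNReal.toReal_ofReal (hw0 b), smul_eq_mul]

/-- **THE ONE-COMPONENT SWAP.**  Replacing the `b`-th law `κ_b` of the mixture by another law `κ'` on `[0,1]` changes the integral of a continuous `g`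
by exactly `w_b·(∫g dκ' − ∫g dκ_b)` (`hasSum_integral_measure` on both mixtures + `HasSum.update'`). [folklore] -/
theorem integral_lawMixture_update_sub (hw0 : ∀ b, 0 ≤ w b) (hw : HasSum w 1) (hκ : ∀ b, κ b (Set.Icc (0 : ℝ) 1)ᶜ = 0)
    (b : ℕ) (κ' : Measure ℝ) [IsProbabilityMeasure κ'] (hκ' : κ' (Set.Icc (0 : ℝ) 1)ᶜ = 0) {g : ℝ → ℝ} (hg : Continuous g) :
    ∫ x, g x ∂(Measure.sum fun b' => ENNReal.ofReal (w b') • Function.update κ b κ' b') -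
      ∫ x, g x ∂(Measure.sum fun b' => ENNReal.ofReal (w b') • κ b') = w b * (∫ x, g x ∂κ' - ∫ x, g x ∂κ b) := by
  classical
  haveI : ∀ b', IsProbabilityMeasure (Function.update κ b κ' b') := fun b' => by
    rcases eq_or_ne b' b with rfl | hb'
    · rw [Function.update_self]; infer_instance
    · rw [Function.update_of_ne hb']; infer_instance
  have hκu : ∀ b', Function.update κ b κ' b' (Set.Icc (0 : ℝ) 1)ᶜ = 0 := fun b' => by
    rcases eq_or_ne b' b with rfl | hb'
    · rw [Function.update_self]; exact hκ'
    · rw [Function.update_of_ne hb']; exact hκ b'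
  have h0 := hasSum_integral_lawMixture (κ := κ) hw0 hw hκ hg
  have h1 := hasSum_integral_lawMixture (κ := Function.update κ b κ') hw0 hw hκu hg
  have e : (fun b' => w b' * ∫ x, g x ∂Function.update κ b κ' b') =
      Function.update (fun b' => w b' * ∫ x, g x ∂κ b') b (w b * ∫ x, g x ∂κ') := by
    funext b'
    rcases eq_or_ne b' b with rfl | hb'
    · rw [Function.update_self, Function.update_self]
    · rw [Function.update_of_ne hb', Function.update_of_ne hb']
  rw [e] at h1
  have h := h0.update' b (w b * ∫ x, g x ∂κ') h1
  linarith

/-! ## §2 ★★ The sequence: `Target` holds (summable window increments), the bounded-Lipschitz increments are `≥ c∕(K+1)` -/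

/-- The block index `b(K) = ⌊log₂(K+1)⌋`: `2^{b(K)} ≤ K + 1 < 2^{b(K)+1}`, and `b(K+1) ≤ b(K) + 1`. [bookkeeping] -/
theorem dyadicBlock_bounds (K : ℕ) :
    2 ^ Nat.log 2 (K + 1) ≤ K + 1 ∧ K + 1 < 2 ^ (Nat.log 2 (K + 1) + 1) ∧ Nat.log 2 (K + 1) ≤ Nat.log 2 (K + 2) ∧
      Nat.log 2 (K + 2) ≤ Nat.log 2 (K + 1) + 1 := by
  refine ⟨Nat.pow_log_le_self 2 (Nat.succ_ne_zero K), Nat.lt_pow_succ_log_self one_lt_two _, Nat.log_mono_right (by omega), ?_⟩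
  have h : K + 2 < 2 ^ (Nat.log 2 (K + 1) + 2) := by
    have := Nat.lt_pow_succ_log_self one_lt_two (K + 1)
    rw [pow_succ] at this ⊢
    omega
  have := (Nat.log_lt_iff_lt_pow one_lt_two (by omega : K + 2 ≠ 0)).2 h
  omega

/-- **★★ `Target` WITHOUT SUMMABLE LAW INCREMENTS.**  For every `l₀ > 0` there are probability laws `λ_K` on `[0,1]` (`K ∈ ℕ`) such that
(i) `Spine.NE7.Target 1 l₀ δ (K ↦ t ↦ mgf λ_K(t))` holds with `δ_K ≤ e^{l₀}∕(2(K+1)²)` — the cgfs `log mgf λ_K` have SUMMABLE increments uniformly on the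
window (matching modulo the constants `0`); (ii) for the `1`-Lipschitz, `[0,1]`-valued test functions `g_K` (cosine waves)
`|∫g_K dλ_{K+1} − ∫g_K dλ_K| ≥ c∕(K+1)` with `c = 1∕(4π(⌈l₀e^{l₀}⌉ + 2)) > 0`; hence (iii) the bounded-Lipschitz increments are NOT summable.
The mixture-of-binomial-pairs construction of the header. [folklore] -/
theorem exists_target_not_summable_lawIncrements {l₀ : ℝ} (hl₀ : 0 < l₀) :
    ∃ Λ : ℕ → Measure ℝ, (∀ K, IsProbabilityMeasure (Λ K)) ∧ (∀ K, Λ K (Set.Icc (0 : ℝ) 1)ᶜ = 0) ∧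
      (∃ δ : ℕ → ℝ, NE7.Target 1 l₀ δ (fun K t => mgf id (Λ K) t) ∧ ∀ K, δ K ≤ Real.exp l₀ / 2 / ((K : ℝ) + 1) ^ 2) ∧
      ∃ g : ℕ → ℝ → ℝ, (∀ K, LipschitzWith 1 (g K)) ∧ (∀ K x, 0 ≤ g K x ∧ g K x ≤ 1) ∧
        (∀ K : ℕ, 1 / (4 * π * (⌈l₀ * Real.exp l₀⌉₊ + 2)) / ((K : ℝ) + 1) ≤ |∫ x, g K x ∂Λ (K + 1) - ∫ x, g K x ∂Λ K|) ∧
        ¬ Summable (fun K => |∫ x, g K x ∂Λ (K + 1) - ∫ x, g K x ∂Λ K|) := by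
  classical
  -- levels `p_b = 2b + 2 + N₀`
  set N₀ : ℕ := ⌈l₀ * Real.exp l₀⌉₊ with hN₀
  have hN₀r : l₀ * Real.exp l₀ ≤ N₀ := Nat.le_ceil _
  set p : ℕ → ℕ := fun b => 2 * b + 2 + N₀ with hpdef
  have hp : ∀ b, 0 < p b := fun b => by simp only [hpdef]; omega
  have hpr : ∀ b, (p b : ℝ) = 2 * b + 2 + N₀ := fun b => by simp only [hpdef]; push_cast; ring
  -- the binomial pairs at level `p_b`
  choose μ ν iμ iν hμ hν ε hε0 hεlo hεhi hmgf hat hcgf hmom htest using fun b => exists_cgf_close_laws_far hl₀ (hp b)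
  haveI : ∀ b, IsProbabilityMeasure (μ b) := iμ
  haveI : ∀ b, IsProbabilityMeasure (ν b) := iν
  -- `ε_b ≤ 2·4^{−(b+1)}`
  have hε : ∀ b, ε b ≤ 2 * (1 / 4 : ℝ) ^ (b + 1) := fun b => by
    refine (hεhi b).trans ?_
    have hratio : l₀ * Real.exp l₀ / (2 * (p b : ℕ)) ≤ 1 / 2 := by
      rw [div_le_div_iff₀ (by have := hp b; positivity) two_pos]
      have : (N₀ : ℝ) ≤ p b := by rw [hpr]; linarith [(Nat.cast_nonneg b : (0 : ℝ) ≤ b)]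
      nlinarith
    have h0 : 0 ≤ l₀ * Real.exp l₀ / (2 * (p b : ℕ)) := by positivity
    calc 2 * (l₀ * Real.exp l₀ / (2 * (p b : ℕ))) ^ p b ≤ 2 * (1 / 2 : ℝ) ^ p b :=
          mul_le_mul_of_nonneg_left (pow_le_pow_left₀ h0 hratio _) two_pos.le
      _ ≤ 2 * (1 / 2 : ℝ) ^ (2 * (b + 1)) :=
          mul_le_mul_of_nonneg_left (pow_le_pow_of_le_one (by norm_num) (by norm_num) (by simp only [hpdef]; omega)) two_pos.le
      _ = 2 * (1 / 4 : ℝ) ^ (b + 1) := by rw [pow_mul]; norm_num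
  -- weights and mixtures
  set w : ℕ → ℝ := fun b => ((b : ℝ) + 1) * (1 / 2 : ℝ) ^ (b + 2) with hwdef
  have hw0 : ∀ b, 0 ≤ w b := fun b => (mixtureWeights_pos_le b).1.le
  have hw4 : ∀ b, w b ≤ 1 / 4 := fun b => (mixtureWeights_pos_le b).2
  have hw : HasSum w 1 := hasSum_mixtureWeights
  set lam0 : Measure ℝ := Measure.sum fun b => ENNReal.ofReal (w b) • μ b with hlam0
  set lam : ℕ → Measure ℝ := fun b => Measure.sum fun b' => ENNReal.ofReal (w b') • Function.update μ b (ν b) b' with hlam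
  haveI i0 : IsProbabilityMeasure lam0 := isProbabilityMeasure_lawMixture (κ := μ) hw0 hw
  haveI iu : ∀ b b', IsProbabilityMeasure (Function.update μ b (ν b) b') := fun b b' => by
    rcases eq_or_ne b' b with rfl | hb'
    · rw [Function.update_self]; exact iν _
    · rw [Function.update_of_ne hb']; exact iμ _
  haveI ib : ∀ b, IsProbabilityMeasure (lam b) := fun b =>
    isProbabilityMeasure_lawMixture (κ := fun b' => Function.update μ b (ν b) b') hw0 hw
  have hlam0c : lam0 (Set.Icc (0 : ℝ) 1)ᶜ = 0 := lawMixture_null measurableSet_Icc hμ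
  have hlamc : ∀ b, lam b (Set.Icc (0 : ℝ) 1)ᶜ = 0 := fun b =>
    lawMixture_null measurableSet_Icc fun b' => by
      rcases eq_or_ne b' b with rfl | hb'
      · rw [Function.update_self]; exact hν _
      · rw [Function.update_of_ne hb']; exact hμ _
  -- the one-component swap, for every continuous `g`
  have hswap : ∀ (b : ℕ) {g : ℝ → ℝ}, Continuous g →
      ∫ x, g x ∂lam b - ∫ x, g x ∂lam0 = w b * (∫ x, g x ∂ν b - ∫ x, g x ∂μ b) := fun b g hg =>
    integral_lawMixture_update_sub (κ := μ) hw0 hw hμ b (ν b) (hν b) hg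
  -- cgf increments between `lam b` and `lam0`: `≤ e^{l₀}·w_b·ε_b ≤ (e^{l₀}∕2)·4^{−(b+1)}`
  have hcgfb : ∀ (b : ℕ) (t : ℝ), |t| ≤ l₀ → |cgf id (lam b) t - cgf id lam0 t| ≤ Real.exp l₀ / 2 * (1 / 4 : ℝ) ^ (b + 1) := by
    intro b t ht
    have hm : |mgf id (lam b) t - mgf id lam0 t| ≤ w b * ε b := by
      have h := hswap b (g := fun x => Real.exp (t * x)) (Real.continuous_exp.comp (continuous_const.mul continuous_id))
      simp only [mgf, id]
      rw [h, abs_mul, abs_of_nonneg (hw0 b)]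
      exact mul_le_mul_of_nonneg_left (by simpa [mgf, id] using hmgf b t ht) (hw0 b)
    calc |cgf id (lam b) t - cgf id lam0 t| = |Real.log (mgf id (lam b) t) - Real.log (mgf id lam0 t)| := by rw [cgf, cgf]
      _ ≤ Real.exp l₀ * |mgf id (lam b) t - mgf id lam0 t| :=
          abs_log_sub_log_le_of_exp_neg_le (exp_neg_le_mgf_id_of_Icc_symm (lam b) (Icc_symm_compl_null_of_Icc (hlamc b)) ht)
            (exp_neg_le_mgf_id_of_Icc_symm lam0 (Icc_symm_compl_null_of_Icc hlam0c) ht)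
      _ ≤ Real.exp l₀ * (w b * ε b) := mul_le_mul_of_nonneg_left hm (Real.exp_pos _).le
      _ ≤ Real.exp l₀ * (1 / 4 * (2 * (1 / 4 : ℝ) ^ (b + 1))) :=
          mul_le_mul_of_nonneg_left (mul_le_mul (hw4 b) (hε b) (hε0 b).le (by norm_num)) (Real.exp_pos _).le
      _ = Real.exp l₀ / 2 * (1 / 4 : ℝ) ^ (b + 1) := by ring
  -- BL payment between `lam b` and `lam0` on the wave of level `p_b`: `= w_b · 2∕(πp_b) ≥ 2^{−(b+1)}∕(π(N₀+2))`
  have hBLb : ∀ b : ℕ, (1 / 2 : ℝ) ^ (b + 1) / (π * (N₀ + 2)) ≤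
      |∫ x, (1 - cos (π * (p b : ℕ) * x)) / (π * (p b : ℕ)) ∂lam b - ∫ x, (1 - cos (π * (p b : ℕ) * x)) / (π * (p b : ℕ)) ∂lam0| := by
    intro b
    have hc : Continuous fun x : ℝ => (1 - cos (π * (p b : ℕ) * x)) / (π * (p b : ℕ)) :=
      (continuous_const.sub (Real.continuous_cos.comp (continuous_const.mul continuous_id))).div_const _
    rw [hswap b hc, abs_mul, abs_of_nonneg (hw0 b), htest b]
    have hb0 : (0 : ℝ) ≤ b := Nat.cast_nonneg b
    have hN0 : (0 : ℝ) ≤ N₀ := Nat.cast_nonneg N₀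
    have hkey : (2 * (b : ℝ) + 2 + N₀) ≤ ((b : ℝ) + 1) * (N₀ + 2) := by nlinarith
    have hq : (0 : ℝ) < 2 * (b : ℝ) + 2 + N₀ := by positivity
    have hA : (0 : ℝ) < (1 / 2 : ℝ) ^ (b + 1) := by positivity
    have e : w b * (2 / (π * (p b : ℕ))) = (1 / 2 : ℝ) ^ (b + 1) * (((b : ℝ) + 1) / (π * (2 * b + 2 + N₀))) := by
      simp only [hwdef]
      rw [hpr, pow_succ]
      field_simp
    rw [e, div_eq_mul_one_div ((1 / 2 : ℝ) ^ (b + 1))]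
    refine mul_le_mul_of_nonneg_left ?_ hA.le
    rw [div_le_div_iff₀ (by positivity) (by positivity), one_mul]
    nlinarith [Real.pi_pos, mul_le_mul_of_nonneg_left hkey Real.pi_pos.le]
  -- the sequence
  set blk : ℕ → ℕ := fun K => Nat.log 2 (K + 1) with hblk
  set Λ : ℕ → Measure ℝ := fun K => if Even K then lam0 else lam (blk K) with hΛ
  -- the level `b′(K)` of the step `K → K+1` and the test function
  set lev : ℕ → ℕ := fun K => if Even K then blk (K + 1) else blk K with hlev
  set g : ℕ → ℝ → ℝ := fun K x => (1 - cos (π * (p (lev K) : ℕ) * x)) / (π * (p (lev K) : ℕ)) with hgdef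
  have hlev_ge : ∀ K, blk K ≤ lev K := fun K => by
    simp only [hlev]; split_ifs
    · exact (dyadicBlock_bounds K).2.2.1
    · exact le_rfl
  have hlev_le : ∀ K, lev K ≤ blk K + 1 := fun K => by
    simp only [hlev]; split_ifs
    · exact (dyadicBlock_bounds K).2.2.2
    · exact Nat.le_succ _
  -- each step is `lam0 ↔ lam (lev K)`
  have hstep : ∀ (K : ℕ) (h : ℝ → ℝ), |∫ x, h x ∂Λ (K + 1) - ∫ x, h x ∂Λ K| = |∫ x, h x ∂lam (lev K) - ∫ x, h x ∂lam0| := by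
    intro K h
    rcases Nat.even_or_odd K with hK | hK
    · have hK1 : ¬Even (K + 1) := Nat.not_even_iff_odd.2 hK.add_one
      simp only [hΛ, hlev, hK, hK1, if_true, if_false]
    · have hK0 : ¬Even K := Nat.not_even_iff_odd.2 hK
      have hK1 : Even (K + 1) := hK.add_one
      simp only [hΛ, hlev, hK0, hK1, if_true, if_false]
      exact abs_sub_comm _ _
  have hstep' : ∀ (K : ℕ) (t : ℝ), |cgf id (Λ (K + 1)) t - cgf id (Λ K) t| = |cgf id (lam (lev K)) t - cgf id lam0 t| := by
    intro K t
    rcases Nat.even_or_odd K with hK | hK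
    · have hK1 : ¬Even (K + 1) := Nat.not_even_iff_odd.2 hK.add_one
      simp only [hΛ, hlev, hK, hK1, if_true, if_false]
    · have hK0 : ¬Even K := Nat.not_even_iff_odd.2 hK
      have hK1 : Even (K + 1) := hK.add_one
      simp only [hΛ, hlev, hK0, hK1, if_true, if_false]
      exact abs_sub_comm _ _
  -- `4^{−(blk K + 1)} ≤ 1∕(K+1)²` and `2^{−(blk K + 2)} ≥ 1∕(4(K+1))`
  have hsq : ∀ K : ℕ, (1 / 4 : ℝ) ^ (blk K + 1) ≤ 1 / ((K : ℝ) + 1) ^ 2 := fun K => by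
    have h' : (K : ℝ) + 1 ≤ (2 : ℝ) ^ (blk K + 1) := by exact_mod_cast (dyadicBlock_bounds K).2.1.le
    have e4 : ((2 : ℝ) ^ (blk K + 1)) ^ 2 = (4 : ℝ) ^ (blk K + 1) := by rw [← pow_mul, mul_comm, pow_mul]; norm_num
    rw [one_div_pow, ← e4]
    exact one_div_le_one_div_of_le (by positivity) (pow_le_pow_left₀ (by positivity) h' 2)
  have hlin : ∀ K : ℕ, 1 / (4 * ((K : ℝ) + 1)) ≤ (1 / 2 : ℝ) ^ (blk K + 2) := fun K => by
    have h' : (2 : ℝ) ^ blk K ≤ (K : ℝ) + 1 := by exact_mod_cast (dyadicBlock_bounds K).1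
    rw [one_div_pow, pow_add, show (2 : ℝ) ^ 2 = 4 by norm_num]
    exact one_div_le_one_div_of_le (by positivity) (by linarith)
  have hc0 : (0 : ℝ) < 1 / (4 * π * ((N₀ : ℝ) + 2)) := by positivity
  -- the lower bound on every increment
  have hBL : ∀ K : ℕ, 1 / (4 * π * ((N₀ : ℝ) + 2)) / ((K : ℝ) + 1) ≤ |∫ x, g K x ∂Λ (K + 1) - ∫ x, g K x ∂Λ K| := by
    intro K
    rw [hstep K]
    refine le_trans ?_ (hBLb (lev K))
    have h1 : (1 / 2 : ℝ) ^ (blk K + 2) ≤ (1 / 2 : ℝ) ^ (lev K + 1) :=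
      pow_le_pow_of_le_one (by norm_num) (by norm_num) (by have := hlev_le K; omega)
    calc 1 / (4 * π * ((N₀ : ℝ) + 2)) / ((K : ℝ) + 1) = 1 / (4 * ((K : ℝ) + 1)) / (π * (N₀ + 2)) := by
          field_simp
      _ ≤ (1 / 2 : ℝ) ^ (blk K + 2) / (π * (N₀ + 2)) := div_le_div_of_nonneg_right (hlin K) (by positivity)
      _ ≤ (1 / 2 : ℝ) ^ (lev K + 1) / (π * (N₀ + 2)) := div_le_div_of_nonneg_right h1 (by positivity)
  refine ⟨Λ, fun K => ?_, fun K => ?_, ⟨fun K => Real.exp l₀ / 2 / ((K : ℝ) + 1) ^ 2, ⟨fun K => ⟨0, fun t ht => ?_⟩, ?_⟩, fun K => le_rfl⟩,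
    g, fun K => ?_, fun K x => ?_, hBL, fun hS => ?_⟩
  · -- probability laws
    simp only [hΛ]; split_ifs
    · exact i0
    · exact ib _
  · -- carried by `[0,1]`
    simp only [hΛ]; split_ifs
    · exact hlam0c
    · exact hlamc _
  · -- matching modulo the constants `0` with `δ_K = e^{l₀}∕(2(K+1)²)`
    rw [sub_zero, one_mul]
    change |cgf id (Λ (K + 1)) t - cgf id (Λ K) t| ≤ _
    rw [hstep' K t]
    calc |cgf id (lam (lev K)) t - cgf id lam0 t| ≤ Real.exp l₀ / 2 * (1 / 4 : ℝ) ^ (lev K + 1) := hcgfb (lev K) t ht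
      _ ≤ Real.exp l₀ / 2 * (1 / 4 : ℝ) ^ (blk K + 1) :=
          mul_le_mul_of_nonneg_left (pow_le_pow_of_le_one (by norm_num) (by norm_num) (by have := hlev_ge K; omega)) (by positivity)
      _ ≤ Real.exp l₀ / 2 * (1 / ((K : ℝ) + 1) ^ 2) := mul_le_mul_of_nonneg_left (hsq K) (by positivity)
      _ = Real.exp l₀ / 2 / ((K : ℝ) + 1) ^ 2 := by ring
  · -- summable
    have hs : Summable (fun K : ℕ => 1 / ((K : ℝ) + 1) ^ 2) := by
      have := (summable_nat_add_iff 1).2 (Real.summable_one_div_nat_pow.2 one_lt_two)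
      simpa [Nat.cast_add, Nat.cast_one] using this
    refine (hs.mul_left (Real.exp l₀ / 2)).congr fun K => ?_
    ring
  · -- `1`-Lipschitz
    simpa only [hgdef] using lipschitzWith_one_cosWave (hp (lev K))
  · -- values in `[0,1]`
    simp only [hgdef]
    refine ⟨cosWave_nonneg _ _, (cosWave_le _ _).trans ?_⟩
    have h2 : (2 : ℝ) ≤ (p (lev K) : ℕ) := by exact_mod_cast (show 2 ≤ p (lev K) by simp only [hpdef]; omega)
    rw [div_le_one (by positivity)]
    nlinarith [Real.pi_gt_three]
  · -- not summable: comparison with the harmonic series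
    have h1 : Summable (fun K : ℕ => 1 / (4 * π * ((N₀ : ℝ) + 2)) / ((K : ℝ) + 1)) :=
      hS.of_nonneg_of_le (fun K => by positivity) hBL
    have h2 : Summable (fun K : ℕ => 1 / ((K : ℝ) + 1)) := by
      refine (h1.mul_left (4 * π * ((N₀ : ℝ) + 2))).congr fun K => ?_
      field_simp
    have h3 : Summable (fun n : ℕ => 1 / ((n + 1 : ℕ) : ℝ)) := h2.congr fun K => by push_cast; rfl
    exact Real.not_summable_one_div_natCast ((summable_nat_add_iff 1).1 h3)

end Summit.QuantumFields.YangMills.Theorems.BalabanUVNodesN19TargetNotLawSummable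

end
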